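import Literature.AlgebraicGeometry.Resolution.AlterationsSemiStableCodimTwoBlowupFlat
import Literature.AlgebraicGeometry.Resolution.CompletionBaseChange
import Mathlib.RingTheory.MvPowerSeries.Equiv
import Mathlib.RingTheory.Nullstellensatz
import HarnessLib

/-!
# De Jong 1996, 3.4 Claim (ii): reduction of the algebraic and formal models modulo the base
# (level-bijectivity, fibres of the charts, rational points)

Topic: `Literature/AlgebraicGeometry/Resolution`. Commutative algebra for the fibre half of
de Jong 1996, 3.4, Claim (ii) ("For the convenience of the reader we give the special fibre
intersected with this chart; it is the spectrum of the ring `k[u, v, v', t₁']/(v - uv', ut₁', v') ≅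
k[u, t₁']/(ut₁')` … all components of the special fibre are smooth, defined over `k`, and … the
singular points are `k`-rational", p. 64), continuing `AlterationsSemiStableCodimTwoBlowupAlgCharts.lean`
(the algebraic model `B' = Λ[u, v]/(uv - c t²)`, `AlgebraicNodeRing`, and the three affine blowup
algebras) and `AlterationsSemiStableCodimTwoBlowupFlat.lean` (`B' → B̂' = Λ⟦u, v⟧/(uv - c t²)`,
`toNodeDeformationRing`):

* level-bijective ring maps (`A/J → B/JB` bijective): permanence under isomorphisms of the
  target, enlarging the level, passing to quotients; `R[X] → R⟦X⟧` is bijective on the levels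
  `(X)ⁿ`; hence **`B' → B̂'` is bijective on the levels `Jⁿ` for every ideal `J ⊇ (u, v)`**
  (`AlgebraicNodeRing.quotientMap_pow_bijective_toNodeDeformationRing`) — the hypothesis of the
  base-change theorem for completions (`completionTensorBaseEquiv`, `CompletionBaseChange.lean`);
* **reduction of the model modulo an ideal of the base**:
  `R[u, v]/(uv - a) ⊗_R R/I = (R/I)[u, v]/(uv - ā)` (`AlgebraicNodeRing.quotientEquiv`);
* **the charts as node rings**: `B'[(ū, v̄, t̄)/ū] ≅ Λ[U, T']/(UT' - t)` (and symmetrically), 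
  `B'[(ū, v̄, t̄)/t̄] ≅ Λ[U', V']/(U'V' - c)`, as `Λ`-algebras (`chartEquivU/V/T`, from
  `range_chartLift(T)` and the injectivity of `chartLift(T)`);
* **closed points are rational**: over an algebraically closed field `K`, every maximal ideal of
  `K[u, v]/(uv - a)` is the kernel of a `K`-point (`AlgebraicNodeRing.exists_algHom_ker_eq`,
  Nullstellensatz);
* a maximal ideal of `A ⊗_D E` over the closed point of a `D`-algebra `E` with `E = D + 𝔪_E`
  contracts to a maximal ideal of `A` (`comap_includeLeft_isMaximal`) — used to see that the
  points of the special fibre of the blow-up met by the comparison with the blown-up curve are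
  closed;
* the residue field of `Λ = k⟦T₁, …, T_m⟧` (`MvPowerSeries.quotientMaximalIdealEquiv`) and the
  transport of the node `K⟦x, y⟧/(xy)` along field isomorphisms.

## Sources

* A. J. de Jong, *Smoothness, semi-stability and alterations*, Publ. Math. IHÉS 83 (1996), 3.3–3.4,
  pp. 63–64. [DeJong1996]
* The Stacks Project, Tag 05GG. [StacksProject]
-/

noncomputable section

namespace Literature.AlgebraicGeometry.Resolution

universe u

open Ideal

section Permanence

variable {A : Type u} [CommRing A] {B : Type u} [CommRing B] {B' : Type u} [CommRing B']

/-- Membership in the image of an ideal under a ring isomorphism. [folklore] -/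
theorem mem_map_ringEquiv_iff (e : B ≃+* B') (K : Ideal B) (x : B) :
    e x ∈ K.map e.toRingHom ↔ x ∈ K := by
  rw [RingEquiv.toRingHom_eq_coe, Ideal.map_comap_of_equiv, Ideal.mem_comap]
  exact Iff.of_eq (congrArg (· ∈ K) (e.symm_apply_apply x))

/-- **Level-bijectivity is invariant under isomorphisms of the target**: for `e : B ≅ B'`,
`A/J → B'/JB'` (along `e ∘ g`) is bijective iff `A/J → B/JB` is. [folklore] -/
theorem quotientMap_bijective_iff_of_ringEquiv (g : A →+* B) (e : B ≃+* B') (J : Ideal A) :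
    Function.Bijective (Ideal.quotientMap (J.map (e.toRingHom.comp g)) (e.toRingHom.comp g)
        Ideal.le_comap_map) ↔
      Function.Bijective (Ideal.quotientMap (J.map g) g Ideal.le_comap_map) := by
  have hmap : J.map (e.toRingHom.comp g) = (J.map g).map e.toRingHom := (Ideal.map_map _ _).symm
  constructor
  · intro h
    constructor
    · rw [quotientMap_injective_iff_forall]
      intro a ha
      refine (quotientMap_injective_iff_forall _ _).mp h.1 a ?_
      rw [hmap]
      exact (mem_map_ringEquiv_iff e _ _).mpr ha
    · rw [quotientMap_surjective_iff_forall]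
      intro b
      obtain ⟨a, ha⟩ := (quotientMap_surjective_iff_forall _ _).mp h.2 (e b)
      refine ⟨a, ?_⟩
      rw [hmap, RingHom.comp_apply, RingEquiv.toRingHom_eq_coe, RingHom.coe_coe, ← map_sub] at ha
      exact (mem_map_ringEquiv_iff e _ _).mp ha
  · intro h
    constructor
    · rw [quotientMap_injective_iff_forall]
      intro a ha
      refine (quotientMap_injective_iff_forall _ _).mp h.1 a ?_
      rw [hmap] at ha
      exact (mem_map_ringEquiv_iff e _ _).mp ha
    · rw [quotientMap_surjective_iff_forall]
      intro b'
      obtain ⟨a, ha⟩ := (quotientMap_surjective_iff_forall _ _).mp h.2 (e.symm b')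
      refine ⟨a, ?_⟩
      rw [hmap, RingHom.comp_apply, RingEquiv.toRingHom_eq_coe, RingHom.coe_coe]
      have h1 : b' - e (g a) = e (e.symm b' - g a) := by rw [map_sub, RingEquiv.apply_symm_apply]
      rw [h1]
      exact (mem_map_ringEquiv_iff e _ _).mpr ha

/-- **Enlarging the level**: if `A/I → B/IB` is bijective then so is `A/J → B/JB` for every
ideal `J ⊇ I` (surjectivity is inherited; for injectivity, `B/IB ≅ A/I` carries `JB/IB` onto
`J/I`). [folklore] -/
theorem quotientMap_bijective_of_le (g : A →+* B) {I J : Ideal A} (hIJ : I ≤ J)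
    (h : Function.Bijective (Ideal.quotientMap (I.map g) g Ideal.le_comap_map)) :
    Function.Bijective (Ideal.quotientMap (J.map g) g Ideal.le_comap_map) := by
  constructor
  · rw [quotientMap_injective_iff_forall]
    intro a ha
    let φ : (A ⧸ I) ≃+* (B ⧸ I.map g) := RingEquiv.ofBijective _ h
    -- `JB/IB = φ(J/I)`
    have hJ : (J.map g).map (Ideal.Quotient.mk (I.map g)) =
        (J.map (Ideal.Quotient.mk I)).map φ.toRingHom := by
      rw [Ideal.map_map, Ideal.map_map]
      congr 1
    have h1 : φ (Ideal.Quotient.mk I a) ∈ (J.map (Ideal.Quotient.mk I)).map φ.toRingHom := by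
      rw [← hJ]
      exact Ideal.mem_map_of_mem _ ha
    rw [mem_map_ringEquiv_iff] at h1
    have h2 : a ∈ (J.map (Ideal.Quotient.mk I)).comap (Ideal.Quotient.mk I) := h1
    rwa [Ideal.comap_map_of_surjective _ Ideal.Quotient.mk_surjective, ← RingHom.ker_eq_comap_bot,
      Ideal.mk_ker, sup_eq_left.mpr hIJ] at h2
  · rw [quotientMap_surjective_iff_forall]
    intro b
    obtain ⟨a, ha⟩ := (quotientMap_surjective_iff_forall _ _).mp h.2 b
    exact ⟨a, Ideal.map_mono hIJ ha⟩

/-- The level `I(A/𝔞)` of `A/𝔞 → B/𝔞B`, pulled back to `B`: it is the image of `(𝔞 ⊔ I)B`.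
[folklore] -/
theorem map_map_mk_quotientMap_eq (g : A →+* B) (𝔞 I : Ideal A) :
    (I.map (Ideal.Quotient.mk 𝔞)).map (Ideal.quotientMap (𝔞.map g) g Ideal.le_comap_map) =
      ((𝔞 ⊔ I).map g).map (Ideal.Quotient.mk (𝔞.map g)) := by
  rw [Ideal.map_map, Ideal.quotientMap_comp_mk, Ideal.map_sup, Ideal.map_sup,
    Ideal.map_quotient_self, bot_sup_eq, Ideal.map_map]

/-- **Level-bijectivity passes to quotients**: if `A/(𝔞 + I) → B/(𝔞 + I)B` is bijective, then
the induced map `Ā = A/𝔞 → B̄ = B/𝔞B` is bijective on the level `IĀ`. [folklore] -/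
theorem quotientMap_bijective_quotient (g : A →+* B) (𝔞 I : Ideal A)
    (h : Function.Bijective (Ideal.quotientMap ((𝔞 ⊔ I).map g) g Ideal.le_comap_map)) :
    Function.Bijective (Ideal.quotientMap
      ((I.map (Ideal.Quotient.mk 𝔞)).map (Ideal.quotientMap (𝔞.map g) g Ideal.le_comap_map))
      (Ideal.quotientMap (𝔞.map g) g Ideal.le_comap_map) Ideal.le_comap_map) := by
  set gbar := Ideal.quotientMap (𝔞.map g) g Ideal.le_comap_map with hgbar
  have hlev := map_map_mk_quotientMap_eq g 𝔞 I
  constructor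
  · rw [quotientMap_injective_iff_forall]
    intro abar habar
    obtain ⟨a, rfl⟩ := Ideal.Quotient.mk_surjective abar
    rw [hlev, hgbar, Ideal.quotientMap_mk] at habar
    have h1 : g a ∈ (((𝔞 ⊔ I).map g).map (Ideal.Quotient.mk (𝔞.map g))).comap
        (Ideal.Quotient.mk (𝔞.map g)) := habar
    rw [Ideal.comap_map_of_surjective _ Ideal.Quotient.mk_surjective, ← RingHom.ker_eq_comap_bot,
      Ideal.mk_ker, sup_eq_left.mpr (Ideal.map_mono le_sup_left)] at h1
    have h2 := (quotientMap_injective_iff_forall _ _).mp h.1 a h1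
    have h3 : Ideal.Quotient.mk 𝔞 a ∈ (𝔞 ⊔ I).map (Ideal.Quotient.mk 𝔞) := Ideal.mem_map_of_mem _ h2
    rwa [Ideal.map_sup, Ideal.map_quotient_self, bot_sup_eq] at h3
  · rw [quotientMap_surjective_iff_forall]
    intro bbar
    obtain ⟨b, rfl⟩ := Ideal.Quotient.mk_surjective bbar
    obtain ⟨a, ha⟩ := (quotientMap_surjective_iff_forall _ _).mp h.2 b
    refine ⟨Ideal.Quotient.mk 𝔞 a, ?_⟩
    rw [hlev, hgbar, Ideal.quotientMap_mk, ← map_sub]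
    exact Ideal.mem_map_of_mem _ ha

/-- On all levels `Jⁿ` at once: bijectivity on the levels `Iⁿ` gives bijectivity on the levels
`Jⁿ` for `J ⊇ I`. [folklore] -/
theorem quotientMap_pow_bijective_of_le (g : A →+* B) {I J : Ideal A} (hIJ : I ≤ J)
    (h : ∀ n, Function.Bijective (Ideal.quotientMap ((I ^ n).map g) g Ideal.le_comap_map))
    (n : ℕ) : Function.Bijective (Ideal.quotientMap ((J ^ n).map g) g Ideal.le_comap_map) :=
  quotientMap_bijective_of_le g (Ideal.pow_right_mono hIJ n) (h n)

end Permanence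

/-! ## Polynomials → power series -/

section Polynomial

variable (σ : Type*) [Finite σ] (R : Type u) [CommRing R]

/-- **`R[X₁, …, X_d] → R⟦X₁, …, X_d⟧` is bijective on all levels `(X)ⁿ`**:
`R[X]/(X)ⁿ ≅ R⟦X⟧/(X)ⁿ` — the power series ring is the `(X)`-adic completion (Mathlib
`MvPowerSeries.toAdicCompletionAlgEquiv`) and the completion is bijective on levels
(`quotientMap_pow_bijective_adicCompletion`). [cite: StacksProject, Tag 05GG] -/
theorem quotientMap_pow_idealOfVars_bijective (n : ℕ) :
    Function.Bijective (Ideal.quotientMap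
      (((MvPolynomial.idealOfVars σ R) ^ n).map
        (algebraMap (MvPolynomial σ R) (MvPowerSeries σ R)))
      (algebraMap (MvPolynomial σ R) (MvPowerSeries σ R)) Ideal.le_comap_map) := by
  set P := MvPolynomial σ R
  let e := (MvPowerSeries.toAdicCompletionAlgEquiv σ R).toRingEquiv
  have hcomp : e.toRingHom.comp (algebraMap P (MvPowerSeries σ R)) =
      algebraMap P (AdicCompletion (MvPolynomial.idealOfVars σ R) P) := by
    exact RingHom.ext fun p => (MvPowerSeries.toAdicCompletionAlgEquiv σ R).commutes p
  have h := quotientMap_pow_bijective_adicCompletion (MvPolynomial.idealOfVars σ R)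
    (MvPolynomial.idealOfVars_fg σ R) n
  rw [← hcomp] at h
  exact (quotientMap_bijective_iff_of_ringEquiv _ e _).mp h

end Polynomial


/-! ## `B' → B̂'` is bijective on the levels `Jⁿ`, `J ⊇ (u, v)` -/

namespace DeJong1996

namespace AlgebraicNodeRing

section Levels

variable (R : Type u) [CommRing R] (a : R)

/-- The ideal of the variables of `R[u, v]` becomes `(ū, v̄)` in `R[u, v]/(uv - a)`. [folklore] -/
theorem map_idealOfVars_mk :
    (MvPolynomial.idealOfVars (Fin 2) R).map (Ideal.Quotient.mk (Ideal.span {algNodeRelation R a})) =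
      Ideal.span {u R a, v R a} := by
  rw [MvPolynomial.idealOfVars, Ideal.map_span]
  congr 1
  ext z
  simp only [Set.mem_image, Set.mem_range, Set.mem_insert_iff, Set.mem_singleton_iff]
  constructor
  · rintro ⟨_, ⟨i, rfl⟩, rfl⟩
    fin_cases i
    · exact Or.inl rfl
    · exact Or.inr rfl
  · rintro (rfl | rfl)
    · exact ⟨MvPolynomial.X 0, ⟨0, rfl⟩, rfl⟩
    · exact ⟨MvPolynomial.X 1, ⟨1, rfl⟩, rfl⟩

/-- `B' → B̂'` is the level map `R[u,v]/(uv - a) → R⟦u,v⟧/(uv - a)R⟦u,v⟧` followed by the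
identification `(uv - a)R⟦u,v⟧ = (uv - a)`. [folklore] -/
theorem toNodeDeformationRing_eq_comp :
    (toNodeDeformationRing R a).toRingHom =
      (Ideal.quotEquivOfEq (map_span_algNodeRelation R a)).toRingHom.comp
        (Ideal.quotientMap ((Ideal.span {algNodeRelation R a}).map
          (algebraMap (MvPolynomial (Fin 2) R) (MvPowerSeries (Fin 2) R)))
          (algebraMap (MvPolynomial (Fin 2) R) (MvPowerSeries (Fin 2) R)) Ideal.le_comap_map) := by
  set P := MvPolynomial (Fin 2) R
  set S := MvPowerSeries (Fin 2) R
  set I : Ideal P := Ideal.span {algNodeRelation R a}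
  refine Ideal.Quotient.ringHom_ext (MvPolynomial.ringHom_ext (fun r => ?_) (fun i => ?_))
  · change toNodeDeformationRing R a (algebraMap R _ r) = _
    rw [AlgHom.commutes, RingHom.comp_apply, RingHom.comp_apply, Ideal.quotientMap_mk,
      MvPowerSeries.algebraMap_apply', Algebra.algebraMap_self, MvPowerSeries.map_id, RingHom.id_apply,
      MvPolynomial.coe_C, RingEquiv.toRingHom_eq_coe, RingHom.coe_coe, Ideal.quotEquivOfEq_mk,
      MvPowerSeries.c_eq_algebraMap]
    rfl
  · change toNodeDeformationRing R a (AlgebraicNodeRing.mk R a (MvPolynomial.X i)) = _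
    rw [RingHom.comp_apply, RingHom.comp_apply, Ideal.quotientMap_mk, MvPowerSeries.algebraMap_apply',
      Algebra.algebraMap_self, MvPowerSeries.map_id, RingHom.id_apply, MvPolynomial.coe_X,
      RingEquiv.toRingHom_eq_coe, RingHom.coe_coe, Ideal.quotEquivOfEq_mk, toNodeDeformationRing,
      lift_mk, MvPolynomial.aeval_X]
    fin_cases i <;> rfl

/-- **`B' = R[u, v]/(uv - a) → B̂' = R⟦u, v⟧/(uv - a)` is bijective on the levels `Jⁿ` for every
ideal `J ⊇ (ū, v̄)`** — e.g. `J = (ū, v̄) + 𝔪_R B'` for `R` local, the maximal ideal at which 3.3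
completes: "`B` is the completion of the algebra `B' = A'[u, v]/(uv - h)` (at the maximal ideal
`𝔪_{A'} B' + (u, v)B'`)". Proof: `R[u,v]/(u,v)ⁿ = R⟦u,v⟧/(u,v)ⁿ`, unchanged by killing `uv - a` on
both sides, and levels only grow more bijective. [cite: DeJong1996, 3.3, p. 63] -/
theorem quotientMap_pow_bijective_toNodeDeformationRing (J : Ideal (AlgebraicNodeRing R a))
    (hJ : Ideal.span {u R a, v R a} ≤ J) (n : ℕ) :
    Function.Bijective (Ideal.quotientMap ((J ^ n).map (toNodeDeformationRing R a).toRingHom)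
      (toNodeDeformationRing R a).toRingHom Ideal.le_comap_map) := by
  set P := MvPolynomial (Fin 2) R
  set S := MvPowerSeries (Fin 2) R
  set g := algebraMap P S
  set 𝔞 : Ideal P := Ideal.span {algNodeRelation R a} with h𝔞
  set I₀ := MvPolynomial.idealOfVars (Fin 2) R
  -- `P → S` on the level `𝔞 + I₀ⁿ`
  have h1 : Function.Bijective (Ideal.quotientMap ((𝔞 ⊔ I₀ ^ n).map g) g Ideal.le_comap_map) :=
    quotientMap_bijective_of_le g le_sup_right (quotientMap_pow_idealOfVars_bijective (Fin 2) R n)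
  -- `P/𝔞 → S/𝔞S` on the level `(ū, v̄)ⁿ`
  have h2 := quotientMap_bijective_quotient g 𝔞 (I₀ ^ n) h1
  rw [Ideal.map_pow, map_idealOfVars_mk] at h2
  -- enlarge to `Jⁿ`, then compose with `S/𝔞S ≅ B̂'`
  have h3 := quotientMap_bijective_of_le _ (Ideal.pow_right_mono hJ n) h2
  rw [toNodeDeformationRing_eq_comp]
  exact (quotientMap_bijective_iff_of_ringEquiv _ _ _).mpr h3

end Levels

/-! ## Reduction of `R[u, v]/(uv - a)` modulo an ideal of `R` -/

section Reduction

variable (R : Type u) [CommRing R] (a : R)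

/-- The relation is compatible with change of coefficients. [folklore] -/
theorem map_algNodeRelation {S : Type u} [CommRing S] (φ : R →+* S) :
    MvPolynomial.map φ (algNodeRelation R a) = algNodeRelation S (φ a) := by
  simp only [algNodeRelation, map_sub, map_mul, MvPolynomial.map_X, MvPolynomial.map_C]

/-- The extension of an ideal `I ⊆ R` to `R[u, v]/(uv - a)` is the image of `I R[u, v]`.
[folklore] -/
theorem map_algebraMap_eq (I : Ideal R) :
    I.map (algebraMap R (AlgebraicNodeRing R a)) =
      (I.map (MvPolynomial.C : R →+* MvPolynomial (Fin 2) R)).map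
        (Ideal.Quotient.mk (Ideal.span {algNodeRelation R a})) := by
  rw [Ideal.map_map]
  rfl

/-- Mathlib's `(R/I)[X] ≅ R[X]/I R[X]`, inverted, on the class of a polynomial: reduce the
coefficients. [folklore] -/
theorem quotientEquivQuotientMvPolynomial_symm_mk (I : Ideal R) (p : MvPolynomial (Fin 2) R) :
    (MvPolynomial.quotientEquivQuotientMvPolynomial (σ := Fin 2) I).symm (Ideal.Quotient.mk _ p) =
      MvPolynomial.map (Ideal.Quotient.mk I) p := by
  set e := MvPolynomial.quotientEquivQuotientMvPolynomial (σ := Fin 2) I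
  have h : (e.symm : (MvPolynomial (Fin 2) R ⧸ I.map (MvPolynomial.C : R →+* MvPolynomial (Fin 2) R)) →+*
        MvPolynomial (Fin 2) (R ⧸ I)).comp (Ideal.Quotient.mk _) =
      MvPolynomial.map (Ideal.Quotient.mk I) := by
    refine MvPolynomial.ringHom_ext (fun r => ?_) (fun i => ?_)
    · rw [RingHom.comp_apply, MvPolynomial.map_C, RingHom.coe_coe, AlgEquiv.symm_apply_eq]
      exact (e.commutes r).symm
    · rw [RingHom.comp_apply, MvPolynomial.map_X, RingHom.coe_coe, AlgEquiv.symm_apply_eq]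
      exact (MvPolynomial.eval₂Hom_X'
        (Ideal.Quotient.lift I ((Ideal.Quotient.mk
          (I.map (MvPolynomial.C : R →+* MvPolynomial (Fin 2) R))).comp MvPolynomial.C)
          fun _ hi => MvPolynomial.quotient_map_C_eq_zero hi)
        (fun j => Ideal.Quotient.mk _ (MvPolynomial.X j)) i).symm
  have h' := RingHom.congr_fun h p
  rwa [RingHom.comp_apply, RingHom.coe_coe] at h'

/-- The relation ideal of `(R/I)[u, v]/(uv - ā)` is the image of that of `R[u, v]/(uv - a)`.
[folklore] -/
theorem span_algNodeRelation_quotient_eq (I : Ideal R) :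
    Ideal.span {algNodeRelation (R ⧸ I) (Ideal.Quotient.mk I a)} =
      (((Ideal.span {algNodeRelation R a}).map
        (Ideal.Quotient.mk (I.map (MvPolynomial.C : R →+* MvPolynomial (Fin 2) R)))).map
        ((MvPolynomial.quotientEquivQuotientMvPolynomial (σ := Fin 2) I).symm.toRingEquiv :
          _ →+* MvPolynomial (Fin 2) (R ⧸ I))) := by
  rw [Ideal.map_span, Set.image_singleton, Ideal.map_span, Set.image_singleton, ← map_algNodeRelation]
  congr 2
  exact (quotientEquivQuotientMvPolynomial_symm_mk R I _).symm

/-- **`R[u, v]/(uv - a)` modulo `I ⊆ R` is `(R/I)[u, v]/(uv - ā)`.** [folklore] -/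
def quotientEquiv (I : Ideal R) :
    (AlgebraicNodeRing R a ⧸ I.map (algebraMap R (AlgebraicNodeRing R a))) ≃+*
      AlgebraicNodeRing (R ⧸ I) (Ideal.Quotient.mk I a) :=
  (Ideal.quotEquivOfEq (map_algebraMap_eq R a I)).trans
    ((DoubleQuot.quotQuotEquivComm (Ideal.span {algNodeRelation R a})
        (I.map (MvPolynomial.C : R →+* MvPolynomial (Fin 2) R))).trans
      (Ideal.quotientEquiv _ _
        (MvPolynomial.quotientEquivQuotientMvPolynomial (σ := Fin 2) I).symm.toRingEquiv
        (span_algNodeRelation_quotient_eq R a I)))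

/-- `quotientEquiv` on the class of a polynomial: reduce the coefficients. [folklore] -/
theorem quotientEquiv_mk_mk (I : Ideal R) (p : MvPolynomial (Fin 2) R) :
    quotientEquiv R a I (Ideal.Quotient.mk _ (mk R a p)) =
      mk (R ⧸ I) (Ideal.Quotient.mk I a) (MvPolynomial.map (Ideal.Quotient.mk I) p) := by
  rw [← quotientEquivQuotientMvPolynomial_symm_mk]
  rfl

/-- `quotientEquiv` on `ū`. [folklore] -/
theorem quotientEquiv_mk_u (I : Ideal R) :
    quotientEquiv R a I (Ideal.Quotient.mk _ (u R a)) = u (R ⧸ I) (Ideal.Quotient.mk I a) := by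
  rw [u, quotientEquiv_mk_mk, MvPolynomial.map_X, u]

/-- `quotientEquiv` on `v̄`. [folklore] -/
theorem quotientEquiv_mk_v (I : Ideal R) :
    quotientEquiv R a I (Ideal.Quotient.mk _ (v R a)) = v (R ⧸ I) (Ideal.Quotient.mk I a) := by
  rw [v, quotientEquiv_mk_mk, MvPolynomial.map_X, v]

/-- `quotientEquiv` on scalars. [folklore] -/
theorem quotientEquiv_mk_algebraMap (I : Ideal R) (r : R) :
    quotientEquiv R a I (Ideal.Quotient.mk _ (algebraMap R _ r)) =
      algebraMap (R ⧸ I) _ (Ideal.Quotient.mk I r) := by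
  rw [show algebraMap R (AlgebraicNodeRing R a) r = mk R a (MvPolynomial.C r) from rfl, quotientEquiv_mk_mk,
    MvPolynomial.map_C]
  rfl

/-- Node rings with equal parameters are canonically isomorphic. [folklore] -/
def congrRight {a a' : R} (h : a = a') : AlgebraicNodeRing R a ≃ₐ[R] AlgebraicNodeRing R a' :=
  Ideal.quotientEquivAlgOfEq R (by rw [h])

/-- `congrRight` on classes. [folklore] -/
@[simp] theorem congrRight_mk {a a' : R} (h : a = a') (p : MvPolynomial (Fin 2) R) :
    congrRight R h (mk R a p) = mk R a' p := by
  subst h; rfl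

end Reduction

/-! ## Closed points of `K[u, v]/(uv - a)` over an algebraically closed field are `K`-points -/

section Points

variable (K : Type u) [Field K] (a : K)

/-- **Every maximal ideal of `K[u, v]/(uv - a)`, `K` algebraically closed, is the kernel of a
`K`-point** `(u, v) ↦ (a₀, b₀)` with `a₀ b₀ = a` (Hilbert's Nullstellensatz for `K[u, v]`,
Mathlib `MvPolynomial.isMaximal_iff_eq_vanishingIdeal_singleton`). [folklore] -/
theorem exists_algHom_ker_eq [IsAlgClosed K] (𝔮 : Ideal (AlgebraicNodeRing K a)) [h𝔮 : 𝔮.IsMaximal] :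
    ∃ χ : AlgebraicNodeRing K a →ₐ[K] K, RingHom.ker χ.toRingHom = 𝔮 := by
  set 𝔮' : Ideal (MvPolynomial (Fin 2) K) := 𝔮.comap (Ideal.Quotient.mk (Ideal.span {algNodeRelation K a}))
  haveI : 𝔮'.IsMaximal := Ideal.comap_isMaximal_of_surjective _ Ideal.Quotient.mk_surjective
  obtain ⟨x, hx⟩ := (MvPolynomial.isMaximal_iff_eq_vanishingIdeal_singleton (I := 𝔮')).mp ‹_›
  have hmem : ∀ p : MvPolynomial (Fin 2) K, mk K a p ∈ 𝔮 ↔ MvPolynomial.aeval x p = 0 := by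
    intro p
    rw [← MvPolynomial.mem_vanishingIdeal_singleton_iff, ← hx, Ideal.mem_comap]
    rfl
  have hrel : x 0 * x 1 = algebraMap K K a := by
    have h0 : mk K a (algNodeRelation K a) = 0 := by
      rw [mk_apply, Ideal.Quotient.eq_zero_iff_mem]
      exact Ideal.subset_span rfl
    have h := (hmem (algNodeRelation K a)).mp (by rw [h0]; exact zero_mem _)
    rwa [algNodeRelation, map_sub, map_mul, MvPolynomial.aeval_X, MvPolynomial.aeval_X,
      MvPolynomial.aeval_C, sub_eq_zero] at h
  refine ⟨AlgebraicNodeRing.lift (x 0) (x 1) hrel, ?_⟩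
  have hx' : (![x 0, x 1] : Fin 2 → K) = x := by ext i; fin_cases i <;> rfl
  ext z
  obtain ⟨p, rfl⟩ := mk_surjective K a z
  rw [RingHom.mem_ker, AlgHom.toRingHom_eq_coe, RingHom.coe_coe, lift_mk, hx', hmem]

end Points

end AlgebraicNodeRing

end DeJong1996

/-! ## Maximal ideals of `A ⊗_D E` over the closed point of `E` -/

section Contraction

open TensorProduct Algebra.TensorProduct

variable {D E A : Type u} [CommRing D] [CommRing E] [CommRing A] [Algebra D E] [Algebra D A]

/-- **A maximal ideal `𝔔` of `A ⊗_D E` containing `1 ⊗ 𝔪_E` contracts to a maximal ideal of `A`**,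
when every element of `E` is a scalar from `D` plus an element of `𝔪_E` (e.g. `E` local with
residue field that of `D`): then `A → (A ⊗_D E)/𝔔` is onto. [folklore] -/
theorem comap_includeLeft_isMaximal (𝔪E : Ideal E) (hE : ∀ x : E, ∃ d : D, x - algebraMap D E d ∈ 𝔪E)
    (𝔔 : Ideal (A ⊗[D] E)) [𝔔.IsMaximal]
    (h𝔔 : 𝔪E.map (includeRight (R := D) (A := A) (B := E)).toRingHom ≤ 𝔔) :
    (𝔔.comap (includeLeftRingHom : A →+* A ⊗[D] E)).IsMaximal := by
  set f : A →+* (A ⊗[D] E) ⧸ 𝔔 := (Ideal.Quotient.mk 𝔔).comp includeLeftRingHom with hf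
  have hsurj : Function.Surjective f := by
    intro z
    obtain ⟨t, rfl⟩ := Ideal.Quotient.mk_surjective z
    induction t using TensorProduct.induction_on with
    | zero => exact ⟨0, by rw [map_zero, map_zero]⟩
    | tmul a' x =>
      obtain ⟨d, hd⟩ := hE x
      refine ⟨d • a', ?_⟩
      have h1 : a' ⊗ₜ[D] x = (d • a') ⊗ₜ[D] (1 : E) + (a' ⊗ₜ[D] (1 : E)) * ((1 : A) ⊗ₜ[D] (x - algebraMap D E d)) := by
        rw [Algebra.TensorProduct.tmul_mul_tmul, mul_one, one_mul, TensorProduct.tmul_sub,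
          Algebra.algebraMap_eq_smul_one, TensorProduct.tmul_smul, TensorProduct.smul_tmul']
        abel
      have h2 : (a' ⊗ₜ[D] (1 : E)) * ((1 : A) ⊗ₜ[D] (x - algebraMap D E d)) ∈ 𝔔 :=
        𝔔.mul_mem_left _ (h𝔔 (Ideal.mem_map_of_mem _ hd))
      rw [h1, map_add, (Ideal.Quotient.eq_zero_iff_mem).mpr h2, add_zero]
      rfl
    | add s t hs ht =>
      obtain ⟨a₁, ha₁⟩ := hs
      obtain ⟨a₂, ha₂⟩ := ht
      exact ⟨a₁ + a₂, by rw [map_add, ha₁, ha₂, map_add]⟩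
  have hker : 𝔔.comap (includeLeftRingHom : A →+* A ⊗[D] E) = RingHom.ker f := by
    rw [hf, ← RingHom.comap_ker, Ideal.mk_ker]
  rw [hker]
  letI := Ideal.Quotient.field 𝔔
  exact RingHom.ker_isMaximal_of_surjective f hsurj

end Contraction

/-! ## The residue field of `k⟦T₁, …, T_m⟧` and the node over isomorphic fields -/

section PowerSeries

variable (k : Type u) [Field k] (σ : Type u)

/-- The maximal ideal of `k⟦T⟧` is the kernel of the constant coefficient. [folklore] -/
theorem MvPowerSeries.maximalIdeal_eq_ker_constantCoeff :
    IsLocalRing.maximalIdeal (MvPowerSeries σ k) = RingHom.ker (MvPowerSeries.constantCoeff (σ := σ) (R := k)) := by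
  ext f
  rw [IsLocalRing.mem_maximalIdeal, mem_nonunits_iff, MvPowerSeries.isUnit_iff_constantCoeff,
    RingHom.mem_ker, isUnit_iff_ne_zero, not_not]

/-- **The residue field of `Λ = k⟦T₁, …, T_m⟧` is `k`**: `Λ/𝔪_Λ ≅ k` by the constant coefficient.
[folklore] -/
def MvPowerSeries.quotientMaximalIdealEquiv :
    (MvPowerSeries σ k ⧸ IsLocalRing.maximalIdeal (MvPowerSeries σ k)) ≃+* k :=
  (Ideal.quotEquivOfEq (MvPowerSeries.maximalIdeal_eq_ker_constantCoeff k σ)).trans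
    (RingHom.quotientKerEquivOfSurjective (f := MvPowerSeries.constantCoeff (σ := σ) (R := k))
      fun x => ⟨MvPowerSeries.C x, MvPowerSeries.constantCoeff_C x⟩)

/-- `quotientMaximalIdealEquiv` on classes is the constant coefficient. [folklore] -/
@[simp] theorem MvPowerSeries.quotientMaximalIdealEquiv_mk (f : MvPowerSeries σ k) :
    MvPowerSeries.quotientMaximalIdealEquiv k σ (Ideal.Quotient.mk _ f) = MvPowerSeries.constantCoeff f :=
  rfl

variable {k}

/-- **The node `K⟦x, y⟧/(xy)` along an isomorphism of fields** `K ≅ K'`. [folklore] -/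
def nodeQuotientCongr {K' : Type u} [Field K'] (e : k ≃+* K') :
    (MvPowerSeries (Fin 2) k ⧸ Ideal.span {(MvPowerSeries.X 0 * MvPowerSeries.X 1 : MvPowerSeries (Fin 2) k)}) ≃+*
      (MvPowerSeries (Fin 2) K' ⧸ Ideal.span {(MvPowerSeries.X 0 * MvPowerSeries.X 1 : MvPowerSeries (Fin 2) K')}) :=
  Ideal.quotientEquiv _ _ (MvPowerSeries.mapRingEquiv (σ := Fin 2) e) (by
    rw [Ideal.map_span, Set.image_singleton, RingHom.coe_coe, map_mul, MvPowerSeries.mapRingEquiv_X,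
      MvPowerSeries.mapRingEquiv_X])

end PowerSeries


/-! ## The three charts of `Bl_{(ū, v̄, t̄)} Spec R[u, v]/(uv - c t²)` as node rings over `R` -/

namespace DeJong1996

section ChartEquiv

open AlgebraicNodeRing

variable {R : Type u} [CommRing R] {B : Type u} [CommRing B] [Algebra R B] (b b' : B) (c t : R)

/-- **Chart "`b ≠ 0`" is the node ring `R[U, T']/(UT' - t)`**, compatibly with the structure
maps from `R` (the isomorphism inside `flat_blowupAlgebra_chart`, exposed). [folklore] -/
theorem exists_ringEquiv_blowupAlgebra_chart (hbb' : b * b' = algebraMap R B (c * t ^ 2))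
    (hgen : Algebra.adjoin R {b, b'} = ⊤) (hind : LinearIndependent R (fun n : ℕ => b ^ n))
    (ht : t ∈ nonZeroDivisors R) :
    ∃ e : AlgebraicNodeRing R t ≃+* blowupAlgebra (chartCentre b b' t) b,
      (algebraMap B (blowupAlgebra (chartCentre b b' t) b)).comp (algebraMap R B) =
        e.toRingHom.comp (algebraMap R (AlgebraicNodeRing R t)) := by
  set S := blowupAlgebra (chartCentre b b' t) b
  have hrange := range_chartLift b b' c t hbb' hgen
  have hinj : Function.Injective (chartLift b t) :=
    lift_injective_of_linearIndependent _ _ _ (linearIndependent_chartFamily b t hind ht)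
  have hmem : ∀ z, (chartLift b t : AlgebraicNodeRing R t →+* Localization.Away b) z ∈ S := by
    intro z
    rw [← SetLike.mem_coe, ← hrange]
    exact ⟨z, rfl⟩
  let φ' : AlgebraicNodeRing R t →+* S := (chartLift b t : _ →+* Localization.Away b).codRestrict S hmem
  have hbij : Function.Bijective φ' := by
    constructor
    · intro z w h
      exact hinj (congrArg Subtype.val h)
    · rintro ⟨y, hy⟩
      rw [← SetLike.mem_coe, ← hrange] at hy
      obtain ⟨z, rfl⟩ := hy
      exact ⟨z, rfl⟩
  refine ⟨RingEquiv.ofBijective φ' hbij, RingHom.ext fun r => Subtype.ext ?_⟩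
  change algebraMap B (Localization.Away b) (algebraMap R B r) =
    chartLift b t (algebraMap R (AlgebraicNodeRing R t) r)
  rw [AlgHom.commutes, ← IsScalarTower.algebraMap_apply]

/-- **Chart "`t ≠ 0`" is the node ring `R[U', V']/(U'V' - c)`**, compatibly with the structure
maps from `R` (the isomorphism inside `flat_blowupAlgebra_chartT`, exposed). [folklore] -/
theorem exists_ringEquiv_blowupAlgebra_chartT (hbb' : b * b' = algebraMap R B (c * t ^ 2))
    (hgen : Algebra.adjoin R {b, b'} = ⊤)
    (hind : LinearIndependent R (Sum.elim (fun i => b ^ i) (fun j => b' ^ (j + 1)) : ℕ ⊕ ℕ → B))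
    (ht : t ∈ nonZeroDivisors R) :
    ∃ e : AlgebraicNodeRing R c ≃+* blowupAlgebra (chartCentre b b' t) (algebraMap R B t),
      (algebraMap B (blowupAlgebra (chartCentre b b' t) (algebraMap R B t))).comp (algebraMap R B) =
        e.toRingHom.comp (algebraMap R (AlgebraicNodeRing R c)) := by
  let S := blowupAlgebra (chartCentre b b' t) (algebraMap R B t)
  let φ := chartLiftT b b' c t hbb'
  have hrange := range_chartLiftT b b' c t hbb' hgen
  have hinj : Function.Injective φ :=
    lift_injective_of_linearIndependent _ _ _ (linearIndependent_chartFamily' b t b' hind ht)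
  have hmem : ∀ z, (φ : AlgebraicNodeRing R c →+* _) z ∈ S := by
    intro z
    rw [← SetLike.mem_coe, ← hrange]
    exact ⟨z, rfl⟩
  let φ' : AlgebraicNodeRing R c →+* S := (φ : _ →+* _).codRestrict S hmem
  have hbij : Function.Bijective φ' := by
    constructor
    · intro z w h
      exact hinj (congrArg Subtype.val h)
    · rintro ⟨y, hy⟩
      rw [← SetLike.mem_coe, ← hrange] at hy
      obtain ⟨z, rfl⟩ := hy
      exact ⟨z, rfl⟩
  refine ⟨RingEquiv.ofBijective φ' hbij, RingHom.ext fun r => Subtype.ext ?_⟩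
  change algebraMap B (Localization.Away (algebraMap R B t)) (algebraMap R B r) =
    φ (algebraMap R (AlgebraicNodeRing R c) r)
  rw [AlgHom.commutes, ← IsScalarTower.algebraMap_apply]

end ChartEquiv

section ChartsConcrete

open AlgebraicNodeRing

variable (R : Type u) [CommRing R] (c t : R)

/-- The generators `ū, v̄, t̄` of the centre. [folklore] -/
abbrev centreGen : Fin 3 → AlgebraicNodeRing R (c * t ^ 2) :=
  ![u R (c * t ^ 2), v R (c * t ^ 2), algebraMap R (AlgebraicNodeRing R (c * t ^ 2)) t]

/-- The parameters of the three chart node rings: `t` (charts `ū ≠ 0`, `v̄ ≠ 0`), `c` (chart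
`t̄ ≠ 0`). [folklore] -/
abbrev chartParam : Fin 3 → R := ![t, t, c]

/-- The centre is spanned by `centreGen`. [folklore] -/
theorem nodalCentre_eq_span_range_centreGen :
    nodalCentre R c t = Ideal.span (Set.range (centreGen R c t)) :=
  nodalCentre_eq_span_range R c t

/-- **The three affine charts of `Bl_{(ū, v̄, t̄)} Spec R[u, v]/(uv - c t²)` are node rings over
`R`** (`t` a non-zero-divisor): `B'[𝔭'/ū] ≅ R[U, T']/(UT' - t)`, `B'[𝔭'/v̄] ≅ R[V, T']/(VT' - t)`,
`B'[𝔭'/t̄] ≅ R[U', V']/(U'V' - c)` — de Jong's charts of p. 64 ("`A[u, v, v', t₁']/(v - uv', t₁ - ut₁', …)`",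
"`A[u, v, u', v']/(u - t₁u', v - t₁v', u'v' - t₁^{n₁-2} ⋯)`"), compatibly with the structure maps
from `R`. [cite: DeJong1996, 3.4, p. 64] -/
theorem exists_ringEquiv_blowupAlgebra_nodalCentre (ht : t ∈ nonZeroDivisors R) (j : Fin 3) :
    ∃ e : AlgebraicNodeRing R (chartParam R c t j) ≃+*
        blowupAlgebra (nodalCentre R c t) (centreGen R c t j),
      (algebraMap (AlgebraicNodeRing R (c * t ^ 2)) (blowupAlgebra (nodalCentre R c t) (centreGen R c t j))).comp
          (algebraMap R (AlgebraicNodeRing R (c * t ^ 2))) =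
        e.toRingHom.comp (algebraMap R (AlgebraicNodeRing R (chartParam R c t j))) := by
  fin_cases j
  · exact exists_ringEquiv_blowupAlgebra_chart _ _ c t (u_mul_v R _) (adjoin_u_v R _)
      (linearIndependent_pow_u R _) ht
  · change ∃ e : AlgebraicNodeRing R t ≃+* blowupAlgebra (nodalCentre R c t) (v R (c * t ^ 2)), _
    rw [nodalCentre, chartCentre_comm]
    refine exists_ringEquiv_blowupAlgebra_chart _ _ c t ?_ ?_ (linearIndependent_pow_v R _) ht
    · exact (mul_comm _ _).trans (u_mul_v R _)
    · rw [Set.pair_comm, adjoin_u_v]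
  · exact exists_ringEquiv_blowupAlgebra_chartT _ _ c t (u_mul_v R _) (adjoin_u_v R _)
      (linearIndependent_pow_u_pow_v R _) ht

end ChartsConcrete

end DeJong1996

end Literature.AlgebraicGeometry.Resolution

end
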